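import Summits.AnomalousDissipation.AnomalousDissipation.Theses.RootDecompCycle1C

/-!
# Glue item `RootDecompCycle1C.DesignerTransferGlue` (stmt-AnomalousDissipation-26784)

Sorry-free proof of the GLUE item of route `route-AnomalousDissipation-RootDecompCycle1C`: `BackgroundInternalisation → BackgroundRemoval → DesignerTransfer` (modus ponens through the inlined hinge AffineDesignerAnomaly).
Pure logic (composition of the pieces / modus ponens); no facts asserted.
Source: decomp-ad cell (lens-6 g3 designerTransfer_of_split); landed by the cell's prover seat.  Nothing here proves the summit.
-/

set_option linter.dupNamespace false

namespace Summit.AnomalousDissipation.AnomalousDissipation.Theorems.CellGlue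

open Summit.AnomalousDissipation.AnomalousDissipation.Theses
open Summit.AnomalousDissipation.AnomalousDissipation.Theses.RootDecompCycle1C

/-- GLUE item 26784 `DesignerTransferGlue` by name (composition of the filed pieces). [folklore] -/
theorem designerTransferGlue_holds : RootDecompCycle1C.DesignerTransferGlue :=
  fun hI hR hA => hR (hI hA)

end Summit.AnomalousDissipation.AnomalousDissipation.Theorems.CellGlue
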